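import Literature.NumberTheory.Sieve.BVAssemblyIntegral
import Literature.NumberTheory.Sieve.MaynardNFPrimes
import HarnessLib

/-!
# Bombieri–Vinogradov over totally real fields: from cubes to the annulus `A(N)`

Topic `Literature/NumberTheory/Sieve`, sub-namespace `BVAssembly` (continued). The region of
Castillo–Hall–Lemke Oliver–Pollack–Thompson is `A(N) = A₀(2N) ∖ A₀(N)`; its class errors
`𝓔(N; 𝔮) = max_u |P(N;𝔮,u) − P(N)/φ(𝔮)|` (`MaynardNF.primesAErr`) are bounded by the cube errors
of `A₀(2N)` and `A₀(N)` (`primesAErr_le_Ecube_add`).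

## References

* A. Castillo, C. Hall, R. J. Lemke Oliver, P. Pollack, L. Thompson, Proc. AMS 143 (2015), §2.1.
  [cite: CastilloEtAl2015, §2.1 (A(N), P(N;𝔮,α₀))]
* J. Hinz, Acta Arith. 51 (1988), Theorem. [cite: Hinz1988, §1 (1.6)]
-/

noncomputable section

open Finset NumberField NumberField.InfinitePlace
  Literature.NumberTheory.Sieve.BoxPrimes Literature.NumberTheory.LFunctions
  Literature.NumberTheory.LFunctions.NumberField Literature.NumberTheory.Sieve.CastilloEtAl2015
  Literature.NumberTheory.Sieve.TypeTwoBlock Literature.NumberTheory.Sieve.MitsuiPNT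
  Literature.NumberTheory.Sieve.MaynardNF
open scoped Classical

namespace Literature.NumberTheory.Sieve.BVAssembly

variable {K : Type*} [Field K] [NumberField K] [IsTotallyReal K]

local notation "d" => Module.finrank ℚ K

omit [IsTotallyReal K] in
/-- `A(N) = A₀(2N) ∖ A₀(N)` as finsets. [cite: CastilloEtAl2015, §2.1 (A(N) = A⁰(2N) ∖ A⁰(N))] -/
theorem regionF_eq_sdiff (N : ℝ) : regionF K N = cubeF K (2 * N) \ cubeF K N := by
  ext α
  rw [mem_regionF, Finset.mem_sdiff, mem_cubeF, mem_cubeF]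
  rfl

omit [IsTotallyReal K] in
/-- `A₀(N) ⊆ A₀(2N)` for `N ≥ 0`. [folklore] -/
theorem cubeF_subset_cubeF_two_mul {N : ℝ} (hN : 0 ≤ N) : cubeF K N ⊆ cubeF K (2 * N) := by
  intro α hα
  rw [mem_cubeF] at hα ⊢
  exact box₀_mono (K := K) (by linarith) hα

omit [NumberField K] [IsTotallyReal K] in
/-- Filters distribute over set difference. [folklore] -/
theorem filter_sdiff_eq (A B : Finset (𝓞 K)) (P : 𝓞 K → Prop) [DecidablePred P] :
    (A \ B).filter P = A.filter P \ B.filter P := by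
  ext α
  simp only [Finset.mem_filter, Finset.mem_sdiff]
  tauto

omit [IsTotallyReal K] in
/-- `P(N; 𝔮, u) = π(A₀(2N); 𝔮, u) − π(A₀(N); 𝔮, u)` (as real numbers), `N ≥ 0`.
[cite: CastilloEtAl2015, §2.1 (P(N;𝔮,α₀))] -/
theorem primesAModQ_eq {N : ℝ} (hN : 0 ≤ N) (𝔮 : Ideal (𝓞 K)) (u : 𝓞 K ⧸ 𝔮) :
    (primesAModQ K N 𝔮 u : ℝ) = piP K (2 * N) 𝔮 u - piP K N 𝔮 u := by
  have hsub : (cubeF K N).filter (fun π => Prime π ∧ Ideal.Quotient.mk 𝔮 π = u) ⊆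
      (cubeF K (2 * N)).filter (fun π => Prime π ∧ Ideal.Quotient.mk 𝔮 π = u) :=
    Finset.filter_subset_filter _ (cubeF_subset_cubeF_two_mul hN)
  unfold primesAModQ piP
  rw [regionF_eq_sdiff, filter_sdiff_eq, Finset.card_sdiff_of_subset hsub, Nat.cast_sub (Finset.card_le_card hsub)]

omit [IsTotallyReal K] in
/-- `P(N) = π(A₀(2N)) − π(A₀(N))`, `N ≥ 0`. [cite: CastilloEtAl2015, §2.1 (P(N))] -/
theorem primesA_eq {N : ℝ} (hN : 0 ≤ N) :
    (primesA K N : ℝ) = primeCount K (2 * N) - primeCount K N := by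
  have hpc : ∀ M : ℝ, primeCount K M = ((cubeF K M).filter Prime).card := fun M => rfl
  have hsub : (cubeF K N).filter Prime ⊆ (cubeF K (2 * N)).filter Prime :=
    Finset.filter_subset_filter _ (cubeF_subset_cubeF_two_mul hN)
  unfold primesA
  rw [hpc, hpc, regionF_eq_sdiff, filter_sdiff_eq, Finset.card_sdiff_of_subset hsub, Nat.cast_sub (Finset.card_le_card hsub)]

omit [IsTotallyReal K] in
/-- **`𝓔(N; 𝔮) ≤ E(A₀(2N); 𝔮) + E(A₀(N); 𝔮)`** for `N ≥ 0`, `𝔮 ≠ 0`.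
[cite: CastilloEtAl2015, §2.1 (A(N) = A⁰(2N) ∖ A⁰(N))] -/
theorem primesAErr_le_Ecube_add {N : ℝ} (hN : 0 ≤ N) {𝔮 : Ideal (𝓞 K)} (h𝔮 : 𝔮 ≠ ⊥) :
    primesAErr K N 𝔮 ≤ Ecube K (2 * N) 𝔮 + Ecube K N 𝔮 := by
  haveI : Finite (𝓞 K ⧸ 𝔮) := Ideal.finiteQuotientOfFreeOfNeBot 𝔮 h𝔮
  unfold primesAErr Ecube
  have hb2 : BddAbove (Set.range fun u : (𝓞 K ⧸ 𝔮)ˣ =>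
      |(piP K (2 * N) 𝔮 (u : 𝓞 K ⧸ 𝔮) : ℝ) - primeCount K (2 * N) / idealTotient K 𝔮|) := Finite.bddAbove_range _
  have hb1 : BddAbove (Set.range fun u : (𝓞 K ⧸ 𝔮)ˣ =>
      |(piP K N 𝔮 (u : 𝓞 K ⧸ 𝔮) : ℝ) - primeCount K N / idealTotient K 𝔮|) := Finite.bddAbove_range _
  refine ciSup_le fun u => ?_
  rw [primesAModQ_eq hN, primesA_eq hN]
  have hsplit : (piP K (2 * N) 𝔮 (u : 𝓞 K ⧸ 𝔮) : ℝ) - piP K N 𝔮 (u : 𝓞 K ⧸ 𝔮) -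
      ((primeCount K (2 * N) : ℝ) - primeCount K N) / idealTotient K 𝔮 =
      ((piP K (2 * N) 𝔮 (u : 𝓞 K ⧸ 𝔮) : ℝ) - primeCount K (2 * N) / idealTotient K 𝔮) -
        ((piP K N 𝔮 (u : 𝓞 K ⧸ 𝔮) : ℝ) - primeCount K N / idealTotient K 𝔮) := by ring
  rw [hsplit]
  refine (abs_sub _ _).trans (add_le_add ?_ ?_)
  · exact le_ciSup hb2 u
  · exact le_ciSup hb1 u

/-! ## Eventual inequalities in `N` used by the parameter choice -/

open Filter Asymptotics in
omit [NumberField K] [IsTotallyReal K] in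
/-- **`(log N)^p ≤ N^η` eventually** (`η > 0`). [folklore] -/
theorem eventually_log_pow_le_rpow (p : ℕ) {η : ℝ} (hη : 0 < η) :
    ∀ᶠ N : ℝ in atTop, Real.log N ^ p ≤ N ^ η := by
  have h := (isLittleO_log_rpow_rpow_atTop (p : ℝ) hη).eventuallyLE
  filter_upwards [h, eventually_ge_atTop (1 : ℝ)] with N hN hN1
  have hlog : 0 ≤ Real.log N := Real.log_nonneg hN1
  rw [Real.rpow_natCast, Real.norm_of_nonneg (pow_nonneg hlog _), Real.norm_of_nonneg (Real.rpow_nonneg (by linarith) _)] at hN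
  exact hN

open Filter Asymptotics in
omit [NumberField K] [IsTotallyReal K] in
/-- **`(log N)^p ≤ exp(c √(log N / 2))` eventually** (`c > 0`). [folklore] -/
theorem eventually_log_pow_le_exp_sqrt (p : ℕ) {c : ℝ} (hc : 0 < c) :
    ∀ᶠ N : ℝ in atTop, Real.log N ^ p ≤ Real.exp (c * Real.sqrt (Real.log N / 2)) := by
  -- in the variable `y = √(log N / 2)`: `(2 y²)^p = 2^p y^{2p} ≤ e^{c y}` eventually
  have hy : Tendsto (fun N : ℝ => Real.sqrt (Real.log N / 2)) atTop atTop :=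
    Real.tendsto_sqrt_atTop.comp ((Real.tendsto_log_atTop).atTop_div_const (by norm_num))
  have h1 : ∀ᶠ y : ℝ in atTop, (2 : ℝ) ^ p * y ^ (2 * p) ≤ Real.exp (c * y) := by
    have h := ((isLittleO_pow_exp_pos_mul_atTop (2 * p) hc).const_mul_left ((2 : ℝ) ^ p)).eventuallyLE
    filter_upwards [h, eventually_ge_atTop (0 : ℝ)] with y hy hy0
    rw [Real.norm_of_nonneg (by positivity), Real.norm_of_nonneg (Real.exp_pos _).le] at hy
    exact hy
  have h2 := hy.eventually h1
  filter_upwards [h2, eventually_ge_atTop (1 : ℝ)] with N hN hN1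
  have hlog : 0 ≤ Real.log N := Real.log_nonneg hN1
  have hsq : Real.sqrt (Real.log N / 2) ^ 2 = Real.log N / 2 := Real.sq_sqrt (by linarith)
  have hL : Real.log N = 2 * Real.sqrt (Real.log N / 2) ^ 2 := by rw [hsq]; ring
  calc Real.log N ^ p = (2 * Real.sqrt (Real.log N / 2) ^ 2) ^ p := by rw [← hL]
    _ = (2 : ℝ) ^ p * Real.sqrt (Real.log N / 2) ^ (2 * p) := by rw [mul_pow, ← pow_mul]
    _ ≤ _ := hN

open Filter in
/-- **Two-sided size of `A(N)`**: eventually `κ/2 (2N)^d ≤ |A(N)| ≤ 2κ (2N)^d`,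
`κ = (1 − 2^{−d})/√|D_K| > 0`. This is `MaynardNF.eventually_cardA_bounds` with
`MaynardNF.boxDensity K` unfolded (kept under this name for the importers that rewrite the explicit `κ`).
[cite: CastilloEtAl2015, proof of Corollary 2.6 (|A(N)| ∼ …)] -/
theorem eventually_cardA_two_sided :
    ∀ᶠ N : ℝ in atTop, (1 - 2⁻¹ ^ d) / √|(discr K : ℝ)| / 2 * (2 * N) ^ d ≤ cardA K N ∧
      (cardA K N : ℝ) ≤ 2 * ((1 - 2⁻¹ ^ d) / √|(discr K : ℝ)|) * (2 * N) ^ d :=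
  eventually_cardA_bounds

omit [IsTotallyReal K] in
/-- Monotonicity of the level-of-distribution sum in `Q`. [folklore] -/
theorem sum_primesAErr_mono (N : ℝ) {Q Q' : ℝ} (h : Q ≤ Q') :
    ∑ 𝔮 ∈ idealsLE K Q, primesAErr K N 𝔮 ≤ ∑ 𝔮 ∈ idealsLE K Q', primesAErr K N 𝔮 :=
  Finset.sum_le_sum_of_subset_of_nonneg (fun 𝔮 h𝔮 => by
    rw [mem_idealsLE] at h𝔮 ⊢; exact ⟨h𝔮.1, h𝔮.2.trans h⟩) fun 𝔮 _ _ => MaynardNF.primesAErr_nonneg N 𝔮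

end Literature.NumberTheory.Sieve.BVAssembly
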